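import Summits.Ventures.HSemireg.WedgeHankelRecurrenceLienardChipartCoefficients

/-!
# Venture HSemireg — ROUTH'S SCHEME AS A MATRIX IDENTITY: for real `p = f(X²) + X g(X²)` put `c = f(0)/g(0)` and `g₁ = (f − c·g)/X`; then **`p` is a Hurwitz polynomial ⟺ c > 0` AND the
# one-degree-smaller `p̃ = g(X²) + X g₁(X²)` is a Hurwitz polynomial** (Holtz 2003 Thm 2, the essence of Routh's 1877 algorithm), proved from the two-Bezoutian criterion N189 and the identities
# `B(g, X·g) = v vᵀ` (`v` = coefficients of `g`), `B(X g₁, X g)` = `B(g₁, g)` bordered by a zero row and column, `B(g, X g₁) = B(g, f)`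

HONEST FRAMING. Part of the Lean index of the computation cell `pub-hsemireg` (seat p10 gen 38, Sunday typer «UNIFORM-IN-n»).
LINEAR ALGEBRA OF REAL SYMMETRIC MATRICES AND REAL POLYNOMIALS ONLY (Mathlib `Matrix.PosDef`; PROVED Literature `Bezoutian`): no variety, no cohomology theory, no sheaf, no Ext group and no
semiregularity map is constructed here; nothing here says that HC / HC_CM / HC_AV holds; no Literature fact (unproved `Prop`) is declared or used.  Custodian versions as in
`WedgeHankelSiegelIdeal` (1/3).
SOURCE (cited; held text read, `paper:arxiv-math_0512591` = O. Holtz, Hermite–Biehler, Routh–Hurwitz, and total positivity, Linear Algebra Appl. 372 (2003) 105–110, §2 chunk p0004):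
«**Theorem 2.** The polynomial `f(x) = p(x²) + xq(x²)`, with `p(x), q(x) ∈ ℝ[x]`, is stable if and only if `c := p(0)/q(0) > 0` and the polynomial `f̃(x) = p̃(x²) + x q̃(x²)` is stable, where
`p̃(x) := q(x)`, `q̃(x) := (1/x)(p(x) − c q(x))`.» — «The following Theorem is the essence of the Routh-Hurwitz scheme. It is proved in monographs using Cauchy indices, Sturm chains or the
principle of the argument … Here is a different elementary argument based on Theorem (hb).»  DICTIONARY: Holtz's `(p, q)` = our `(f, g)`, `q̃` = `g₁ = (f − C c * g).divX`.
THIS FILE'S PROOF (new, matrix-algebraic): N189 gives `p` Hurwitz `⟺ B(f, X·g) ≻ 0 ∧ B(g, f) ≻ 0` and `p̃` Hurwitz `⟺ B(g, X·g₁) ≻ 0 ∧ B(g₁, g) ≻ 0` (all sizes below); `X g₁ = f − c g` gives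
`B(g, X g₁) = B(g, f)` (the Bezoutian is alternating), and `f = c g + X g₁` gives `xᵀ B(f, X g) x = c (Σ g_i x_i)² + x′ᵀ B(g₁, g) x′` (`x′ = (x_1, …)`), whence `B(f, Xg) ≻ 0 ⟺ c·g(0)² > 0 ∧
B(g₁, g) ≻ 0` by bordering (`posDef_iff_of_border`).
DEDUP DISCLOSURE (`rg` of the whole tree + Mathlib, 2026-09-02): Literature `Bezoutian` has `bezCoeff_X_mul_left_succ/zero` (one factor `X`), N155–N157 (`BezoutianEuclid*`) the EUCLIDEAN step
`m = C′a + r` (signature additivity); the Routh step (`X`-division after killing the constant term), `B(g, Xg) = vvᵀ`, the double-`X` bordering and Holtz's Thm 2 are new (the dyad identity `xᵀvvᵀx = (v·x)²` exists PRIVATELY in two Literature files and is inlined as a `have`).  14 names: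
0 hits tree-wide + Mathlib.

WHAT IS IN THE TREE.  N189 `forall_re_neg_iff_posDef_bezoutian_and` (general two-Bezoutian criterion); N190 `natDegree_even_add_odd_of_lt_left ∕ _of_le_right`; N198
`leadingCoeff_mul_coeff_pos_of_forall_re_neg`; N201 `coeff_odd_eq`; Literature `Bezoutian`: `bezCoeff_X_mul_left_succ`, `bezCoeff_X_mul_left_zero`, `bezCoeff_swap`, `bezCoeff_comm`,
`bezCoeff_self`, `bezoutian_add_left/right`, `bezoutian_smul_left/right`, `bezoutian_self`, `bezoutian_isSymm`.  Mathlib: `Matrix.posDef_iff_dotProduct_mulVec`, `Polynomial.divX`,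
`X_mul_divX_add`, `natDegree_divX_eq_natDegree_tsub_one`, `Fin.sum_univ_succ`.
THIS FILE (namespace `Summit.Ventures.HSemireg.Wedge.HankelOuter` continued; CHAINED on N201; 0 definitions):
* §896 BEZOUTIAN IDENTITIES (any commutative ring): `bezCoeff_self_X_mul` (`b_ij(g, Xg) = g_i g_j`), `bezoutian_self_X_mul` (`= vecMulVec`), `bezCoeff_X_mul_X_mul_zero_right ∕ _zero_left ∕
  _succ_succ` (`B(Xa, Xb)` is `B(a, b)` bordered by zeros), `bezoutian_routh_right` (`B(g, X g₁) = B(g, f)` for `f = c g + X g₁`).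
* §897 QUADRATIC FORMS (real): `dotProduct_bezoutian_X_mul_X_mul_mulVec` (the bordering on forms), `dotProduct_bezoutian_routh_mulVec`
  (`xᵀ B(f, Xg) x = c (v·x)² + x′ᵀ B(g₁, g) x′`), **`posDef_iff_of_border`** (`B ≻ 0 ⟺ c v₀² > 0 ∧ M ≻ 0` for such a form), `posDef_bezoutian_X_mul_iff_routh`.
* §898 ROUTH'S STEP: `eq_C_mul_add_X_mul_divX` (`f = c g + X g₁`), `coeff_zero_ne_zero_of_forall_re_neg` (`g(0) ≠ 0` for Hurwitz `p`), **`forall_re_neg_iff_routh_of_even`** (`deg p = 2m + 4 ↦ deg p̃ = 2m + 3`), **`forall_re_neg_iff_routh_of_odd`** (`deg p = 2m + 3 ↦ deg p̃ = 2m + 2`); `c` and `g₁` are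
  spelled `f.coeff 0 / g.coeff 0` and `(f − C (f.coeff 0 / g.coeff 0) * g).divX` in the statements (if `g(0) = 0` both sides are false).
CAVEATS.  The last step `deg 2 ↦ deg 1` is not restated (degree two is N196 `forall_re_neg_quadratic_iff`); no Routh TABLE (iteration bookkeeping) is defined — only the step, which is the
mathematical content.  Nothing Ext-side.  New names only.
-/

open Module Polynomial
open scoped Matrix Polynomial

namespace Summit.Ventures.HSemireg.Wedge.HankelOuter

open Summit.Ventures.HSemireg.Wedge Summit.Ventures.HSemireg.Wedge.Hankel
open Literature.LinearAlgebra.Matrix.Bezoutian (bezCoeff bezoutian bezoutian_apply bezoutian_isSymm bezoutian_swap bezoutian_smul_left bezoutian_smul_right bezoutian_add_left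
  bezoutian_add_right bezoutian_self bezCoeff_X_mul_left_succ bezCoeff_X_mul_left_zero bezCoeff_swap bezCoeff_comm bezCoeff_self)

/-! ## §896. Bezoutian identities for the Routh step -/

section Identities

variable {R : Type*} [CommRing R]

/-- **`b_{ij}(g, X·g) = g_i g_j`**: the Bezoutian form of `g` and `X g` is `(z g(z) g(w) − g(z) w g(w))/(z − w) = g(z) g(w)`. [this file, §896] -/
theorem bezCoeff_self_X_mul (g : R[X]) (i j : ℕ) : bezCoeff g (Polynomial.X * g) i j = g.coeff i * g.coeff j := by
  rw [bezCoeff_swap]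
  cases j with
  | zero => rw [bezCoeff_X_mul_left_zero, neg_neg]
  | succ j => rw [bezCoeff_X_mul_left_succ, bezCoeff_self, zero_sub, neg_neg]

/-- **`B_n(g, X·g) = v vᵀ`** with `v_i = g_i`. [this file, §896] -/
theorem bezoutian_self_X_mul (n : ℕ) (g : R[X]) : bezoutian n g (Polynomial.X * g) = Matrix.vecMulVec (fun i : Fin n => g.coeff i) (fun j : Fin n => g.coeff j) := by
  ext i j
  rw [bezoutian_apply, bezCoeff_self_X_mul, Matrix.vecMulVec_apply]

/-- `b_{i,0}(Xa, Xb) = 0`. [this file, §896] -/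
theorem bezCoeff_X_mul_X_mul_zero_right (a b : R[X]) (i : ℕ) : bezCoeff (Polynomial.X * a) (Polynomial.X * b) i 0 = 0 := by
  rw [bezCoeff_X_mul_left_zero, coeff_X_mul_zero, mul_zero, neg_zero]

/-- `b_{0,j}(Xa, Xb) = 0`. [this file, §896] -/
theorem bezCoeff_X_mul_X_mul_zero_left (a b : R[X]) (j : ℕ) : bezCoeff (Polynomial.X * a) (Polynomial.X * b) 0 j = 0 := by
  rw [← bezCoeff_comm, bezCoeff_X_mul_X_mul_zero_right]

/-- **`b_{i+1,j+1}(Xa, Xb) = b_{ij}(a, b)`**: the form of `(Xa, Xb)` is `zw·` the form of `(a, b)`. [this file, §896] -/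
theorem bezCoeff_X_mul_X_mul_succ_succ (a b : R[X]) (i j : ℕ) : bezCoeff (Polynomial.X * a) (Polynomial.X * b) (i + 1) (j + 1) = bezCoeff a b i j := by
  have h1 : bezCoeff a (Polynomial.X * b) (i + 1) j = -bezCoeff (Polynomial.X * b) a (i + 1) j := bezCoeff_swap (Polynomial.X * b) a (i + 1) j
  have h2 : bezCoeff (Polynomial.X * b) a (i + 1) j = bezCoeff b a j i - b.coeff j * a.coeff (i + 1) := by
    rw [← bezCoeff_comm, bezCoeff_X_mul_left_succ]
  have h3 : bezCoeff b a j i = -bezCoeff a b i j := by rw [bezCoeff_swap, bezCoeff_comm]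
  rw [bezCoeff_X_mul_left_succ, coeff_X_mul, h1, h2, h3]
  ring

/-- **`B_n(g, X·g₁) = B_n(g, f)` when `f = c·g + X·g₁`** (the Bezoutian is bilinear and alternating). [this file, §896] -/
theorem bezoutian_routh_right (n : ℕ) {f g g₁ : R[X]} {c : R} (hf : f = C c * g + Polynomial.X * g₁) : bezoutian n g (Polynomial.X * g₁) = bezoutian n g f := by
  rw [hf, bezoutian_add_right, ← smul_eq_C_mul, bezoutian_smul_right, bezoutian_self, smul_zero, zero_add]

end Identities

/-! ## §897. The quadratic forms and the bordering lemma -/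

/-- **The bordering on forms: `xᵀ B_{k+1}(Xa, Xb) x = x′ᵀ B_k(a, b) x′`** with `x′_i = x_{i+1}`. [this file §897] -/
theorem dotProduct_bezoutian_X_mul_X_mul_mulVec {R : Type*} [CommRing R] (k : ℕ) (a b : R[X]) (x : Fin (k + 1) → R) :
    x ⬝ᵥ (bezoutian (k + 1) (Polynomial.X * a) (Polynomial.X * b) *ᵥ x) = (x ∘ Fin.succ) ⬝ᵥ (bezoutian k a b *ᵥ (x ∘ Fin.succ)) := by
  simp only [dotProduct, Matrix.mulVec, Fin.sum_univ_succ, bezoutian_apply, Fin.val_zero, Fin.val_succ, bezCoeff_X_mul_X_mul_zero_left, bezCoeff_X_mul_X_mul_zero_right,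
    bezCoeff_X_mul_X_mul_succ_succ, zero_mul, mul_zero, Finset.sum_const_zero, zero_add, Function.comp_apply]

/-- **`xᵀ B_{k+1}(f, X·g) x = c·(Σ g_i x_i)² + x′ᵀ B_k(g₁, g) x′` for `f = c·g + X·g₁`.** [this file §897] -/
theorem dotProduct_bezoutian_routh_mulVec {k : ℕ} {f g g₁ : ℝ[X]} {c : ℝ} (hf : f = C c * g + Polynomial.X * g₁) (x : Fin (k + 1) → ℝ) :
    x ⬝ᵥ (bezoutian (k + 1) f (Polynomial.X * g) *ᵥ x) = c * ((fun i : Fin (k + 1) => g.coeff i) ⬝ᵥ x) ^ 2 + (x ∘ Fin.succ) ⬝ᵥ (bezoutian k g₁ g *ᵥ (x ∘ Fin.succ)) := by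
  -- the quadratic form of a dyad: `xᵀ (v vᵀ) x = (v·x)²` (folklore; PROVED privately elsewhere in the tree, inlined here)
  have hdyad : ∀ v : Fin (k + 1) → ℝ, x ⬝ᵥ (Matrix.vecMulVec v v *ᵥ x) = (v ⬝ᵥ x) ^ 2 := fun v => by
    simp only [dotProduct, Matrix.mulVec, Matrix.vecMulVec_apply, sq, Finset.sum_mul_sum]
    refine Finset.sum_congr rfl fun i _ => ?_
    rw [Finset.mul_sum]
    exact Finset.sum_congr rfl fun j _ => by ring
  rw [hf, bezoutian_add_left, ← smul_eq_C_mul, bezoutian_smul_left, Matrix.add_mulVec, dotProduct_add, Matrix.smul_mulVec, dotProduct_smul, bezoutian_self_X_mul,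
    hdyad, dotProduct_bezoutian_X_mul_X_mul_mulVec, smul_eq_mul]

/-- **The bordering lemma: if `xᵀ B x = c (v·x)² + x′ᵀ M x′` for all `x` (`x′ = x ∘ succ`), then `B ≻ 0 ⟺ c·v₀² > 0 ∧ M ≻ 0`** (real symmetric `B`, `M`). (`⇒`: test `e₀`, and lift `y ≠ 0` to
`x = (x₀, y)` with `v·x = 0`; `⇐`: split `x′ = 0` / `x′ ≠ 0`.) [this file §897] -/
theorem posDef_iff_of_border {k : ℕ} {B : Matrix (Fin (k + 1)) (Fin (k + 1)) ℝ} {M : Matrix (Fin k) (Fin k) ℝ} (hB : B.IsSymm) (hM : M.IsSymm) {c : ℝ} {v : Fin (k + 1) → ℝ}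
    (hform : ∀ x : Fin (k + 1) → ℝ, x ⬝ᵥ (B *ᵥ x) = c * (v ⬝ᵥ x) ^ 2 + (x ∘ Fin.succ) ⬝ᵥ (M *ᵥ (x ∘ Fin.succ))) :
    B.PosDef ↔ 0 < c * v 0 ^ 2 ∧ M.PosDef := by
  rw [Matrix.posDef_iff_dotProduct_mulVec, Matrix.posDef_iff_dotProduct_mulVec]
  simp only [star_trivial, Matrix.isHermitian_iff_isSymm]
  constructor
  · rintro ⟨-, h⟩
    -- test vector `e₀`
    have h0 : 0 < c * v 0 ^ 2 := by
      have := h (x := Pi.single 0 1) (by simp)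
      rw [hform, dotProduct_single, mul_one] at this
      have hz : (Pi.single (0 : Fin (k + 1)) (1 : ℝ)) ∘ Fin.succ = 0 := by
        funext j; simp
      rwa [hz, Matrix.mulVec_zero, dotProduct_zero, add_zero] at this
    have hv0 : v 0 ≠ 0 := by rintro hv; rw [hv] at h0; simp at h0
    refine ⟨h0, hM, fun y hy => ?_⟩
    -- lift `y` to `x = (x₀, y)` with `v · x = 0`
    set x : Fin (k + 1) → ℝ := Fin.cons (-(∑ i : Fin k, v i.succ * y i) / v 0) y with hx
    have hxs : x ∘ Fin.succ = y := by funext i; simp [hx]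
    have hvx : v ⬝ᵥ x = 0 := by
      rw [dotProduct, Fin.sum_univ_succ]
      simp only [hx, Fin.cons_zero, Fin.cons_succ]
      field_simp
      ring
    have hx0 : x ≠ 0 := fun h0' => hy (by rw [← hxs, h0']; rfl)
    have := h hx0
    rwa [hform, hvx, hxs, zero_pow two_ne_zero, mul_zero, zero_add] at this
  · rintro ⟨hc, -, hMpos⟩
    have hc' : 0 < c := by
      rcases lt_trichotomy c 0 with h | h | h
      · nlinarith [sq_nonneg (v 0)]
      · rw [h, zero_mul] at hc; exact absurd hc (lt_irrefl _)
      · exact h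
    refine ⟨hB, fun x hx => ?_⟩
    rw [hform]
    by_cases hy : x ∘ Fin.succ = 0
    · have hx0 : x 0 ≠ 0 := by
        intro h0
        apply hx
        funext i
        refine Fin.cases ?_ (fun j => ?_) i
        · exact h0
        · exact congr_fun hy j
      have hvx : v ⬝ᵥ x = v 0 * x 0 := by
        rw [dotProduct, Fin.sum_univ_succ]
        have : ∑ i : Fin k, v i.succ * x i.succ = 0 := Finset.sum_eq_zero fun i _ => by rw [show x i.succ = (x ∘ Fin.succ) i from rfl, hy]; simp
        rw [this, add_zero]
      rw [hy, Matrix.mulVec_zero, dotProduct_zero, add_zero, hvx]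
      have hv0 : v 0 ≠ 0 := by rintro hv; rw [hv] at hc; simp at hc
      exact mul_pos hc' (sq_pos_iff.2 (mul_ne_zero hv0 hx0))
    · exact add_pos_of_nonneg_of_pos (mul_nonneg hc'.le (sq_nonneg _)) (hMpos hy)

/-- **`B_{k+1}(f, X·g) ≻ 0 ⟺ c·g(0)² > 0 ∧ B_k(g₁, g) ≻ 0` for `f = c·g + X·g₁`** (real polynomials, any `k`). [this file §897] -/
theorem posDef_bezoutian_X_mul_iff_routh {k : ℕ} {f g g₁ : ℝ[X]} {c : ℝ} (hf : f = C c * g + Polynomial.X * g₁) :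
    (bezoutian (k + 1) f (Polynomial.X * g)).PosDef ↔ 0 < c * g.coeff 0 ^ 2 ∧ (bezoutian k g₁ g).PosDef :=
  posDef_iff_of_border (v := fun i : Fin (k + 1) => g.coeff i) (bezoutian_isSymm _ _ _) (bezoutian_isSymm _ _ _) (dotProduct_bezoutian_routh_mulVec hf)

/-! ## §898. Routh's step -/

/-- If `g(0) ≠ 0` then `f = c·g + X·g₁` with `c = f(0)/g(0)` and `g₁ = (f − c g)/X`. [bookkeeping; this file §898] -/
theorem eq_C_mul_add_X_mul_divX {f g : ℝ[X]} (hg0 : g.coeff 0 ≠ 0) : f = C (f.coeff 0 / g.coeff 0) * g + Polynomial.X * (f - C (f.coeff 0 / g.coeff 0) * g).divX := by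
  have h := X_mul_divX_add (f - C (f.coeff 0 / g.coeff 0) * g)
  have h0 : (f - C (f.coeff 0 / g.coeff 0) * g).coeff 0 = 0 := by
    rw [coeff_sub, coeff_C_mul, div_mul_cancel₀ _ hg0, sub_self]
  rw [h0, map_zero, add_zero] at h
  rw [h, add_sub_cancel]

/-- A Hurwitz `p = f(X²) + X g(X²)` of positive degree has `g(0) = p_1 ≠ 0`. [N198; this file §898] -/
theorem coeff_zero_ne_zero_of_forall_re_neg {f g : ℝ[X]} (hp : 1 ≤ (expand ℝ 2 f + Polynomial.X * expand ℝ 2 g).natDegree)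
    (h : ∀ z ∈ ((expand ℝ 2 f + Polynomial.X * expand ℝ 2 g).map (algebraMap ℝ ℂ)).roots, z.re < 0) : g.coeff 0 ≠ 0 := by
  have hp0 : expand ℝ 2 f + Polynomial.X * expand ℝ 2 g ≠ 0 := by rintro h0; rw [h0, natDegree_zero] at hp; exact absurd hp (by omega)
  have := leadingCoeff_mul_coeff_pos_of_forall_re_neg hp0 h 1 hp
  rw [show (1 : ℕ) = 2 * 0 + 1 by ring, coeff_odd_eq] at this
  intro hg0
  rw [hg0, mul_zero] at this
  exact lt_irrefl _ this

/-- **ROUTH'S STEP, EVEN DEGREE (Holtz Thm 2): for `p = f(X²) + X g(X²)` with `deg f = m + 2`, `deg g ≤ m + 1` (so `deg p = 2m + 4`), put `c = f(0)/g(0)`, `g₁ = (f − c g)/X`; then `p` is a Hurwitz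
polynomial iff `c > 0` and `p̃ = g(X²) + X g₁(X²)` (degree `2m + 3`) is a Hurwitz polynomial.** [Holtz 2003 Thm 2 (Routh 1877); this file §898] -/
theorem forall_re_neg_iff_routh_of_even (m : ℕ) {f g : ℝ[X]} (hf : f.natDegree = m + 2) (hg : g.natDegree ≤ m + 1) :
    (∀ z ∈ ((expand ℝ 2 f + Polynomial.X * expand ℝ 2 g).map (algebraMap ℝ ℂ)).roots, z.re < 0) ↔
      0 < f.coeff 0 / g.coeff 0 ∧
        ∀ z ∈ ((expand ℝ 2 g + Polynomial.X * expand ℝ 2 (f - C (f.coeff 0 / g.coeff 0) * g).divX).map (algebraMap ℝ ℂ)).roots, z.re < 0 := by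
  set c := f.coeff 0 / g.coeff 0 with hc
  set g₁ := (f - C c * g).divX with hg₁
  have hp : (expand ℝ 2 f + Polynomial.X * expand ℝ 2 g).natDegree = 2 * m + 4 := by
    rw [natDegree_even_add_odd_of_lt_left (by omega), hf]; ring
  by_cases hg0 : g.coeff 0 = 0
  · have hc0 : c = 0 := by rw [hc, hg0, div_zero]
    refine ⟨fun h => absurd hg0 (coeff_zero_ne_zero_of_forall_re_neg (by rw [hp]; omega) h), fun h => ?_⟩
    rw [hc0] at h
    exact absurd h.1 (lt_irrefl _)
  have hfg : f = C c * g + Polynomial.X * g₁ := eq_C_mul_add_X_mul_divX hg0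
  have hsub : (f - C c * g).natDegree = m + 2 := by
    rw [natDegree_sub_eq_left_of_natDegree_lt (lt_of_le_of_lt ((natDegree_C_mul_le _ _).trans hg) (by omega)), hf]
  have hg₁d : g₁.natDegree = m + 1 := by rw [hg₁, natDegree_divX_eq_natDegree_tsub_one, hsub]; rfl
  have hg₁0 : g₁ ≠ 0 := by rintro h0; rw [h0, natDegree_zero] at hg₁d; omega
  have hp₁ : (expand ℝ 2 g + Polynomial.X * expand ℝ 2 g₁).natDegree = 2 * m + 3 := by
    rw [natDegree_even_add_odd_of_le_right hg₁0 (by omega), hg₁d]; ring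
  rw [forall_re_neg_iff_posDef_bezoutian_and (t := 2 * m + 3) (m₁ := m + 1) (m₂ := m + 1) (by ring) le_rfl (Nat.le_succ _) f g (by omega),
    forall_re_neg_iff_posDef_bezoutian_and (t := 2 * m + 2) (m₁ := m + 1) (m₂ := m) (by ring) (Nat.le_succ _) le_rfl g g₁ (by omega),
    bezoutian_routh_right (m + 1 + 1) hfg, posDef_bezoutian_X_mul_iff_routh hfg, mul_pos_iff_of_pos_right (sq_pos_iff.2 hg0)]
  tauto

/-- **ROUTH'S STEP, ODD DEGREE (Holtz Thm 2): for `p = f(X²) + X g(X²)` with `deg g = m + 1`, `deg f ≤ m + 1` (so `deg p = 2m + 3`), with `c = f(0)/g(0)`, `g₁ = (f − c g)/X`: `p` is a Hurwitz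
polynomial iff `c > 0` and `p̃ = g(X²) + X g₁(X²)` (degree `2m + 2`) is a Hurwitz polynomial.** [Holtz 2003 Thm 2 (Routh 1877); this file §898] -/
theorem forall_re_neg_iff_routh_of_odd (m : ℕ) {f g : ℝ[X]} (hg : g.natDegree = m + 1) (hf : f.natDegree ≤ m + 1) :
    (∀ z ∈ ((expand ℝ 2 f + Polynomial.X * expand ℝ 2 g).map (algebraMap ℝ ℂ)).roots, z.re < 0) ↔
      0 < f.coeff 0 / g.coeff 0 ∧
        ∀ z ∈ ((expand ℝ 2 g + Polynomial.X * expand ℝ 2 (f - C (f.coeff 0 / g.coeff 0) * g).divX).map (algebraMap ℝ ℂ)).roots, z.re < 0 := by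
  set c := f.coeff 0 / g.coeff 0 with hc
  set g₁ := (f - C c * g).divX with hg₁
  have hg0' : g ≠ 0 := by rintro rfl; simp at hg
  have hp : (expand ℝ 2 f + Polynomial.X * expand ℝ 2 g).natDegree = 2 * m + 3 := by
    rw [natDegree_even_add_odd_of_le_right hg0' (by omega), hg]; ring
  by_cases hg0 : g.coeff 0 = 0
  · have hc0 : c = 0 := by rw [hc, hg0, div_zero]
    refine ⟨fun h => absurd hg0 (coeff_zero_ne_zero_of_forall_re_neg (by rw [hp]; omega) h), fun h => ?_⟩
    rw [hc0] at h
    exact absurd h.1 (lt_irrefl _)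
  have hfg : f = C c * g + Polynomial.X * g₁ := eq_C_mul_add_X_mul_divX hg0
  have hg₁d : g₁.natDegree ≤ m := by
    rw [hg₁, natDegree_divX_eq_natDegree_tsub_one]
    have : (f - C c * g).natDegree ≤ m + 1 := (natDegree_sub_le _ _).trans (max_le hf ((natDegree_C_mul_le _ _).trans hg.le))
    omega
  have hp₁ : (expand ℝ 2 g + Polynomial.X * expand ℝ 2 g₁).natDegree = 2 * m + 2 := by
    rw [natDegree_even_add_odd_of_lt_left (by omega), hg]; ring
  rw [forall_re_neg_iff_posDef_bezoutian_and (t := 2 * m + 2) (m₁ := m + 1) (m₂ := m) (by ring) (Nat.le_succ _) le_rfl f g (by omega),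
    forall_re_neg_iff_posDef_bezoutian_and (t := 2 * m + 1) (m₁ := m) (m₂ := m) (by ring) le_rfl (Nat.le_succ _) g g₁ (by omega),
    bezoutian_routh_right (m + 1) hfg, posDef_bezoutian_X_mul_iff_routh hfg, mul_pos_iff_of_pos_right (sq_pos_iff.2 hg0)]
  tauto

end Summit.Ventures.HSemireg.Wedge.HankelOuter
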